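import Mathlib
import Literature.Geometry.Lorentzian.CauchyDevelopment
import Literature.Geometry.Lorentzian.CauchyDevelopmentGlobalHyperbolicityProofs
import Literature.Geometry.Lorentzian.CauchyHypersurfaceGlobalHyperbolicity
import Literature.Geometry.Lorentzian.NonImprisonmentProofs
import Literature.Geometry.Lorentzian.CausalCurveNullGeodesic
import Literature.Geometry.Lorentzian.CausalFutureProofs

/-!
# Route PhotonSphereChannels · crux `TameCensorship` (stmt-FinalStateConjecture-17431) · line `Sketch`, skeleton v6 ·
# stub `stub_causalCurve_eventually_mem_causalFuture`: a future-endless causal curve of a Cauchy development is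
# eventually in `J⁺(ιΣ)`

Helper file (`--supports stmt-FinalStateConjecture-17431`) of line `Sketch` (lead c2, 2026-08-17), brick S15 of the
PANCAKE LAW (tail form): the tail of a visible future-incomplete null geodesic of a Cauchy development lies in the
outer region `J⁺(ιΣ) ∩ {visible}`, where clause (ii) of the crux supplies tame charts. This file is the causal-curve
half: in a Cauchy development `𝒟 = (M, g, τ, ι, ν)` of initial data on a connected `3`-manifold `X`, a future-endless
future-directed causal curve `γ` on an order-connected parameter set `s` eventually stays in the causal future
`J⁺(ι X)` of the Cauchy hypersurface `ι(X)`. It is the causal twin of the timelike-ray theorem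
`LorentzianMetric.IsCauchyHypersurface.exists_forall_mem_causalFuture_of_isFutureEndless` (`TimelikeRayCauchy.lean`),
proved WITHOUT curve concatenation:

* pick `t₀ ∈ s`; by O'Neill's Lemma 14.29 (`M = J⁺(S) ∪ J⁻(S)` for a Cauchy hypersurface `S`,
  `IsCauchyHypersurface.mem_causalFuture_or_mem_causalPast`) either `γ t₀ ∈ J⁺(ι X)` — and then every later point
  `γ t'` lies in `J⁺(γ t₀) ⊆ J⁺(J⁺(ι X)) = J⁺(ι X)` (`causalFuture_causalFuture_eq`) — or `γ t₀ ∈ J⁻(ι X)`;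
* in the second case `K = J⁺(γ t₀) ∩ J⁻(ι X)` is compact (Hawking–Ellis 1973, Prop. 6.6.6,
  `CauchyDevelopment.isCompact_causalFuture_inter_causalPast_range`), the development is strongly causal
  (`CauchyDevelopment.isStronglyCausal`), so by non-imprisonment (O'Neill 1983, Ch. 14, Lemma 13,
  `IsStronglyCausal.exists_forall_notMem`) `γ` leaves `K` for good after some `t₁ ∈ s`; for `t' ≥ max t₀ t₁`,
  `γ t' ∈ J⁺(γ t₀) ∖ K`, hence `γ t' ∉ J⁻(ι X)`, hence `γ t' ∈ J⁺(ι X)` by the dichotomy again.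

References: B. O'Neill, *Semi-Riemannian Geometry with Applications to Relativity* (1983), Ch. 14, Lemma 13
(p. 407, non-imprisonment) and Lemma 29 (p. 415, `M = I⁻(S) ⊔ S ⊔ I⁺(S)`); S. W. Hawking, G. F. R. Ellis, *The large
scale structure of space-time* (1973), §6.4, Prop. 6.4.7 and §6.6, Prop. 6.6.6.
-/

set_option linter.dupNamespace false

open Literature.Geometry.Lorentzian
open scoped Manifold ContDiff Topology
open Set Filter

noncomputable section

namespace Summit.FinalStateConjecture.FinalStateConjecture.Theorems.PhotonSphereChannels.TameCensorshipUnwind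

/-- **Stub `stub_causalCurve_eventually_mem_causalFuture` of line `Sketch` (skeleton v6) for the crux
`PhotonSphereChannels.TameCensorship` (stmt-FinalStateConjecture-17431): a future-endless future-directed causal
curve of a Cauchy development is eventually in `J⁺(ιΣ)`.** For a Cauchy development `𝒟` of initial data `D` on a
connected `3`-manifold `X`, a future causal curve `γ` on an order-connected parameter set `s` without future
endpoint satisfies `γ t' ∈ J⁺(ι X)` for all `t' ∈ s`, `t' ≥ t`, for some `t ∈ s`. Proof (module docstring): the
dichotomy `M = J⁺(ι X) ∪ J⁻(ι X)` (O'Neill 1983, Lemma 14.29) at `γ t₀`; in the case `γ t₀ ∈ J⁻(ι X)` the compact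
set `J⁺(γ t₀) ∩ J⁻(ι X)` (Hawking–Ellis 1973, Prop. 6.6.6) is eventually left by `γ` (non-imprisonment under the
strong causality of Cauchy developments, O'Neill 1983, Ch. 14, Lemma 13), after which `γ ⊆ J⁺(γ t₀) ∖ J⁻(ι X) ⊆
J⁺(ι X)`. [cite: ONeillSemiRiemannian1983, Ch. 14, Lemma 13 (p. 407) and Lemma 29 (p. 415)] -/
theorem stub_causalCurve_eventually_mem_causalFuture :
    ∀ (X : Type) [TopologicalSpace X] [ChartedSpace E3 X] [IsManifold (𝓡 3) ∞ X] [ConnectedSpace X]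
    (D : InitialDataSet (𝓡 3) X) (𝒟 : CauchyDevelopment D) (γ : ℝ → 𝒟.carrier) (s : Set ℝ),
    s.OrdConnected → 𝒟.metric.IsFutureCausalCurveOn 𝒟.timeOrientation γ s → IsFutureEndless γ s →
    ∃ t ∈ s, ∀ t' ∈ s, t ≤ t' →
      γ t' ∈ 𝒟.metric.causalFuture 𝒟.timeOrientation (Set.range 𝒟.embed) := by
  intro X _ _ _ _ D 𝒟 γ s hs hγ hend
  -- standing facts: the metric is `C^∞`, so `2 ≤ ∞`; `ι X` is a Cauchy hypersurface
  have hn2 : (2 : ℕ∞ω) ≤ ∞ := WithTop.coe_le_coe.mpr le_top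
  have hS := 𝒟.isCauchyHypersurface
  -- every later point of `γ` lies in `J⁺(γ t₀)`, along `γ|[t₀, t']`
  have hlater : ∀ t₀ ∈ s, ∀ t' ∈ s, t₀ ≤ t' →
      γ t' ∈ 𝒟.metric.causalFuture 𝒟.timeOrientation {γ t₀} := fun t₀ ht₀ t' ht' h ↦
    (hγ.mono (hs.out ht₀ ht')).apply_mem_causalFuture_apply_left ⟨h, le_rfl⟩
  -- `J⁺(γ t₀) ⊆ J⁺(ι X)` as soon as `γ t₀ ∈ J⁺(ι X)` (`J⁺ ∘ J⁺ = J⁺`)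
  have htrans : ∀ {x y : 𝒟.carrier}, x ∈ 𝒟.metric.causalFuture 𝒟.timeOrientation (range 𝒟.embed) →
      y ∈ 𝒟.metric.causalFuture 𝒟.timeOrientation {x} →
      y ∈ 𝒟.metric.causalFuture 𝒟.timeOrientation (range 𝒟.embed) := fun {x y} hx hy ↦ by
    rw [← LorentzianMetric.causalFuture_causalFuture_eq hn2 (range 𝒟.embed)]
    exact LorentzianMetric.causalFuture_mono (singleton_subset_iff.mpr hx) hy
  obtain ⟨t₀, ht₀⟩ := hend.nonempty
  rcases hS.mem_causalFuture_or_mem_causalPast hn2 (γ t₀) with h₀ | h₀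
  · -- (a) `γ t₀ ∈ J⁺(ι X)`: the whole tail after `t₀` is in `J⁺(ι X)`
    exact ⟨t₀, ht₀, fun t' ht' h ↦ htrans h₀ (hlater t₀ ht₀ t' ht' h)⟩
  · -- (b) `γ t₀ ∈ J⁻(ι X)`: `γ` eventually leaves the compact set `J⁺(γ t₀) ∩ J⁻(ι X)`
    obtain ⟨t₁, ht₁, hout⟩ :=
      LorentzianMetric.IsStronglyCausal.exists_forall_notMem hn2 𝒟.isStronglyCausal
        (𝒟.isCompact_causalFuture_inter_causalPast_range (γ t₀)) hs hγ hend
    have htmem : max t₀ t₁ ∈ s := by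
      rcases le_total t₀ t₁ with h | h
      · rwa [max_eq_right h]
      · rwa [max_eq_left h]
    refine ⟨max t₀ t₁, htmem, fun t' ht' h ↦ ?_⟩
    have h₀t' : γ t' ∈ 𝒟.metric.causalFuture 𝒟.timeOrientation {γ t₀} :=
      hlater t₀ ht₀ t' ht' ((le_max_left _ _).trans h)
    have hnot : γ t' ∉ 𝒟.metric.causalPast 𝒟.timeOrientation (range 𝒟.embed) := fun hP ↦
      hout t' ht' ((le_max_right _ _).trans h) ⟨h₀t', hP⟩
    exact (hS.mem_causalFuture_or_mem_causalPast hn2 (γ t')).resolve_right hnot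

end Summit.FinalStateConjecture.FinalStateConjecture.Theorems.PhotonSphereChannels.TameCensorshipUnwind

end
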